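import Mathlib

/-!
# `stub_fiveFoldContinuation` from its three parts (reduction, card A of `GapTwelveToBarlow`)

Crux `SquareWellLayerCake.GapTwelveToBarlow` (stmt-AtomisticToContinuum-15807), line `Sketch`,
stub `stub_fiveFoldContinuation` (S2β, the D5h continuation of five-fold order).  Write
`Good j` for the three verbatim clauses at the site `j` (sites within `11/10` of `x j` are
`55/57`-separated from everything; exactly twelve other sites within `1`; at most twelve within
`11/10`), `Dich j` for the local dichotomy (two sites within `1` of `x j` are at distance `≤ 1`
or `≥ 131/100`), `S j k` for the common neighbours of `j` and `k` within `1`, and call a bond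
`(j, k)` (`k ≠ j`, `|x j - x k| ≤ 1`) FIVE-FOLD when `#S j k = 5`.  The stub says: if `(j, k)`
is five-fold then `j` carries EXACTLY two five-fold bonds and the other one makes an angle of
cosine `≤ -19/20` with `(j, k)`.  It is (losslessly) the conjunction of three statements, each
under the hypotheses `Good j`, `Dich j`, `(j, k)` five-fold:

* (ADJ)  *no adjacent five-fold bonds*: a second five-fold bond `(j, k')`, `k' ≠ k`, has
  `|x k - x k'| > 1` (by `Dich`, `≥ 131/100`) — numerically the delicate part (two adjacent
  closed pentagonal caps complete to a twelve-shell iff the gap constant is `≲ 1.27`);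
* (FAR)  *far five-fold bonds are antipodal*: a five-fold bond `(j, k')` with `|x k - x k'| > 1`
  has `⟪x k - x j, x k' - x j⟫ ≤ -(19/20)·‖x k - x j‖·‖x k' - x j‖`;
* (EX)   *continuation*: there IS a second five-fold bond `(j, k')`, `k' ≠ k`.

This file proves the assembly `(ADJ) → (FAR) → (EX) → stub_fiveFoldContinuation` (verbatim
conclusion): the angle clause is (ADJ) then (FAR); the count is `≥ 2` by (EX) and `≤ 2` because
three vectors pairwise at cosine `≤ -19/20` do not exist
(`0 ≤ ‖Σ‖² ≤ (3 - 6·19/20)·(product of norms)² < 0`, `not_three_pairwise_antipodal`).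

Mathlib only; no named fact is used.
-/

namespace Summit.AtomisticToContinuum.Crystallization.Theorems.SquareWellLayerCakeGapTwelveToBarlow

open scoped RealInnerProductSpace

/-- **No three pairwise nearly antipodal vectors.**  Three non-zero vectors of a real inner
product space cannot have all three pairwise cosines `≤ -19/20` (indeed not all `< -1/2`):
expand `0 ≤ ‖a•u + b•v + c•w‖²` with `a = ‖v‖‖w‖`, `b = ‖u‖‖w‖`, `c = ‖u‖‖v‖`. [folklore] -/
theorem not_three_pairwise_antipodal {E : Type*} [NormedAddCommGroup E] [InnerProductSpace ℝ E]
    (u v w : E) (hu : 0 < ‖u‖) (hv : 0 < ‖v‖) (hw : 0 < ‖w‖)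
    (huv : ⟪u, v⟫ ≤ -((19 : ℝ) / 20) * (‖u‖ * ‖v‖))
    (huw : ⟪u, w⟫ ≤ -((19 : ℝ) / 20) * (‖u‖ * ‖w‖))
    (hvw : ⟪v, w⟫ ≤ -((19 : ℝ) / 20) * (‖v‖ * ‖w‖)) : False := by
  obtain ⟨a, ha⟩ : ∃ a : ℝ, a = ‖v‖ * ‖w‖ := ⟨_, rfl⟩
  obtain ⟨b, hb⟩ : ∃ b : ℝ, b = ‖u‖ * ‖w‖ := ⟨_, rfl⟩
  obtain ⟨c, hc⟩ : ∃ c : ℝ, c = ‖u‖ * ‖v‖ := ⟨_, rfl⟩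
  have ha0 : 0 < a := ha ▸ mul_pos hv hw
  have hb0 : 0 < b := hb ▸ mul_pos hu hw
  have hc0 : 0 < c := hc ▸ mul_pos hu hv
  have hP : 0 < ‖u‖ * ‖v‖ * ‖w‖ := mul_pos (mul_pos hu hv) hw
  have h0 : 0 ≤ ⟪a • u + b • v + c • w, a • u + b • v + c • w⟫ := real_inner_self_nonneg
  have hexp : ⟪a • u + b • v + c • w, a • u + b • v + c • w⟫ =
      a * a * (‖u‖ * ‖u‖) + b * b * (‖v‖ * ‖v‖) + c * c * (‖w‖ * ‖w‖) +
        2 * (a * b) * ⟪u, v⟫ + 2 * (a * c) * ⟪u, w⟫ + 2 * (b * c) * ⟪v, w⟫ := by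
    simp only [inner_add_left, inner_add_right, real_inner_smul_left, real_inner_smul_right]
    simp only [real_inner_self_eq_norm_mul_norm, real_inner_comm u v, real_inner_comm u w,
      real_inner_comm v w]
    ring
  have h1 : a * b * ⟪u, v⟫ ≤ a * b * (-((19 : ℝ) / 20) * (‖u‖ * ‖v‖)) :=
    mul_le_mul_of_nonneg_left huv (mul_pos ha0 hb0).le
  have h2 : a * c * ⟪u, w⟫ ≤ a * c * (-((19 : ℝ) / 20) * (‖u‖ * ‖w‖)) :=
    mul_le_mul_of_nonneg_left huw (mul_pos ha0 hc0).le
  have h3 : b * c * ⟪v, w⟫ ≤ b * c * (-((19 : ℝ) / 20) * (‖v‖ * ‖w‖)) :=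
    mul_le_mul_of_nonneg_left hvw (mul_pos hb0 hc0).le
  -- everything is a multiple of `P² = (‖u‖‖v‖‖w‖)²`
  have hid1 : a * a * (‖u‖ * ‖u‖) = (‖u‖ * ‖v‖ * ‖w‖) ^ 2 := by rw [ha]; ring
  have hid2 : b * b * (‖v‖ * ‖v‖) = (‖u‖ * ‖v‖ * ‖w‖) ^ 2 := by rw [hb]; ring
  have hid3 : c * c * (‖w‖ * ‖w‖) = (‖u‖ * ‖v‖ * ‖w‖) ^ 2 := by rw [hc]; ring
  have hid4 : a * b * (-((19 : ℝ) / 20) * (‖u‖ * ‖v‖)) = -(19 / 20) * (‖u‖ * ‖v‖ * ‖w‖) ^ 2 := by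
    rw [ha, hb]; ring
  have hid5 : a * c * (-((19 : ℝ) / 20) * (‖u‖ * ‖w‖)) = -(19 / 20) * (‖u‖ * ‖v‖ * ‖w‖) ^ 2 := by
    rw [ha, hc]; ring
  have hid6 : b * c * (-((19 : ℝ) / 20) * (‖v‖ * ‖w‖)) = -(19 / 20) * (‖u‖ * ‖v‖ * ‖w‖) ^ 2 := by
    rw [hb, hc]; ring
  have hP2 : 0 < (‖u‖ * ‖v‖ * ‖w‖) ^ 2 := pow_pos hP 2
  rw [hexp] at h0
  linarith [h0, h1, h2, h3, hid1, hid2, hid3, hid4, hid5, hid6, hP2]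

/-- **`stub_fiveFoldContinuation` from its parts.**  Under `Good j`, the local dichotomy and a
five-fold bond `(j, k)`: if (ADJ) a second five-fold bond is never adjacent to `k`, (FAR) a
non-adjacent second five-fold bond is nearly antipodal, and (EX) a second five-fold bond
exists, then `j` carries exactly two five-fold bonds, nearly antipodal — the conclusion of
`stub_fiveFoldContinuation`, verbatim. [folklore] -/
theorem fiveFoldContinuation_of_parts
    (hADJ : ∀ (N : ℕ) (x : Fin N → EuclideanSpace ℝ (Fin 3)) (j k : Fin N),
      ((∀ j' : Fin N, dist (x j) (x j') ≤ 11 / 10 → ∀ k' : Fin N, k' ≠ j' →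
          (55 : ℝ) / 57 ≤ dist (x j') (x k')) ∧
        (Finset.univ.filter fun j' : Fin N => j' ≠ j ∧ dist (x j) (x j') ≤ 1).card = 12 ∧
        (Finset.univ.filter fun j' : Fin N => j' ≠ j ∧ dist (x j) (x j') ≤ 11 / 10).card ≤ 12) →
      (∀ l l' : Fin N, dist (x j) (x l) ≤ 1 → dist (x j) (x l') ≤ 1 → 1 < dist (x l) (x l') →
        (131 : ℝ) / 100 ≤ dist (x l) (x l')) →
      j ≠ k → dist (x j) (x k) ≤ 1 →
      (Finset.univ.filter fun l : Fin N =>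
        l ≠ j ∧ l ≠ k ∧ dist (x j) (x l) ≤ 1 ∧ dist (x k) (x l) ≤ 1).card = 5 →
      ∀ k' : Fin N, k' ≠ j → k' ≠ k → dist (x j) (x k') ≤ 1 →
        (Finset.univ.filter fun l : Fin N =>
          l ≠ j ∧ l ≠ k' ∧ dist (x j) (x l) ≤ 1 ∧ dist (x k') (x l) ≤ 1).card = 5 →
        1 < dist (x k) (x k'))
    (hFAR : ∀ (N : ℕ) (x : Fin N → EuclideanSpace ℝ (Fin 3)) (j k : Fin N),
      ((∀ j' : Fin N, dist (x j) (x j') ≤ 11 / 10 → ∀ k' : Fin N, k' ≠ j' →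
          (55 : ℝ) / 57 ≤ dist (x j') (x k')) ∧
        (Finset.univ.filter fun j' : Fin N => j' ≠ j ∧ dist (x j) (x j') ≤ 1).card = 12 ∧
        (Finset.univ.filter fun j' : Fin N => j' ≠ j ∧ dist (x j) (x j') ≤ 11 / 10).card ≤ 12) →
      (∀ l l' : Fin N, dist (x j) (x l) ≤ 1 → dist (x j) (x l') ≤ 1 → 1 < dist (x l) (x l') →
        (131 : ℝ) / 100 ≤ dist (x l) (x l')) →
      j ≠ k → dist (x j) (x k) ≤ 1 →
      (Finset.univ.filter fun l : Fin N =>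
        l ≠ j ∧ l ≠ k ∧ dist (x j) (x l) ≤ 1 ∧ dist (x k) (x l) ≤ 1).card = 5 →
      ∀ k' : Fin N, k' ≠ j → dist (x j) (x k') ≤ 1 →
        (Finset.univ.filter fun l : Fin N =>
          l ≠ j ∧ l ≠ k' ∧ dist (x j) (x l) ≤ 1 ∧ dist (x k') (x l) ≤ 1).card = 5 →
        1 < dist (x k) (x k') →
        inner ℝ (x k - x j) (x k' - x j) ≤ -((19 : ℝ) / 20) * (‖x k - x j‖ * ‖x k' - x j‖))
    (hEX : ∀ (N : ℕ) (x : Fin N → EuclideanSpace ℝ (Fin 3)) (j k : Fin N),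
      ((∀ j' : Fin N, dist (x j) (x j') ≤ 11 / 10 → ∀ k' : Fin N, k' ≠ j' →
          (55 : ℝ) / 57 ≤ dist (x j') (x k')) ∧
        (Finset.univ.filter fun j' : Fin N => j' ≠ j ∧ dist (x j) (x j') ≤ 1).card = 12 ∧
        (Finset.univ.filter fun j' : Fin N => j' ≠ j ∧ dist (x j) (x j') ≤ 11 / 10).card ≤ 12) →
      (∀ l l' : Fin N, dist (x j) (x l) ≤ 1 → dist (x j) (x l') ≤ 1 → 1 < dist (x l) (x l') →
        (131 : ℝ) / 100 ≤ dist (x l) (x l')) →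
      j ≠ k → dist (x j) (x k) ≤ 1 →
      (Finset.univ.filter fun l : Fin N =>
        l ≠ j ∧ l ≠ k ∧ dist (x j) (x l) ≤ 1 ∧ dist (x k) (x l) ≤ 1).card = 5 →
      ∃ k' : Fin N, k' ≠ j ∧ k' ≠ k ∧ dist (x j) (x k') ≤ 1 ∧
        (Finset.univ.filter fun l : Fin N =>
          l ≠ j ∧ l ≠ k' ∧ dist (x j) (x l) ≤ 1 ∧ dist (x k') (x l) ≤ 1).card = 5) :
    ∀ (N : ℕ) (x : Fin N → EuclideanSpace ℝ (Fin 3)) (j k : Fin N),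
      ((∀ j' : Fin N, dist (x j) (x j') ≤ 11 / 10 → ∀ k' : Fin N, k' ≠ j' →
          (55 : ℝ) / 57 ≤ dist (x j') (x k')) ∧
        (Finset.univ.filter fun j' : Fin N => j' ≠ j ∧ dist (x j) (x j') ≤ 1).card = 12 ∧
        (Finset.univ.filter fun j' : Fin N => j' ≠ j ∧ dist (x j) (x j') ≤ 11 / 10).card ≤ 12) →
      (∀ l l' : Fin N, dist (x j) (x l) ≤ 1 → dist (x j) (x l') ≤ 1 → 1 < dist (x l) (x l') →
        (131 : ℝ) / 100 ≤ dist (x l) (x l')) →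
      j ≠ k → dist (x j) (x k) ≤ 1 →
      (Finset.univ.filter fun l : Fin N =>
        l ≠ j ∧ l ≠ k ∧ dist (x j) (x l) ≤ 1 ∧ dist (x k) (x l) ≤ 1).card = 5 →
      (Finset.univ.filter fun k' : Fin N => k' ≠ j ∧ dist (x j) (x k') ≤ 1 ∧
        (Finset.univ.filter fun l : Fin N =>
          l ≠ j ∧ l ≠ k' ∧ dist (x j) (x l) ≤ 1 ∧ dist (x k') (x l) ≤ 1).card = 5).card = 2 ∧
      ∀ k' : Fin N, k' ≠ j → dist (x j) (x k') ≤ 1 →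
        (Finset.univ.filter fun l : Fin N =>
          l ≠ j ∧ l ≠ k' ∧ dist (x j) (x l) ≤ 1 ∧ dist (x k') (x l) ≤ 1).card = 5 → k' ≠ k →
        inner ℝ (x k - x j) (x k' - x j) ≤ -((19 : ℝ) / 20) * (‖x k - x j‖ * ‖x k' - x j‖) := by
  classical
  intro N x j k hGood hDich hjk hdjk h5
  -- the angle clause between ANY two five-fold bonds at `j`
  have hangle : ∀ a b : Fin N, a ≠ j → dist (x j) (x a) ≤ 1 →
      (Finset.univ.filter fun l : Fin N =>
        l ≠ j ∧ l ≠ a ∧ dist (x j) (x l) ≤ 1 ∧ dist (x a) (x l) ≤ 1).card = 5 →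
      b ≠ j → dist (x j) (x b) ≤ 1 →
      (Finset.univ.filter fun l : Fin N =>
        l ≠ j ∧ l ≠ b ∧ dist (x j) (x l) ≤ 1 ∧ dist (x b) (x l) ≤ 1).card = 5 →
      b ≠ a →
      inner ℝ (x a - x j) (x b - x j) ≤ -((19 : ℝ) / 20) * (‖x a - x j‖ * ‖x b - x j‖) := by
    intro a b haj hdja ha5 hbj hdjb hb5 hba
    have hfar : 1 < dist (x a) (x b) :=
      hADJ N x j a hGood hDich haj.symm hdja ha5 b hbj hba hdjb hb5
    exact hFAR N x j a hGood hDich haj.symm hdja ha5 b hbj hdjb hb5 hfar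
  refine ⟨?_, fun k' hk'j hdjk' hk'5 hk'k => hangle k k' hjk.symm hdjk h5 hk'j hdjk' hk'5 hk'k⟩
  -- the count: `≥ 2` from (EX), `≤ 2` from `hangle` and `not_three_pairwise_antipodal`
  set T := Finset.univ.filter fun k' : Fin N => k' ≠ j ∧ dist (x j) (x k') ≤ 1 ∧
    (Finset.univ.filter fun l : Fin N =>
      l ≠ j ∧ l ≠ k' ∧ dist (x j) (x l) ≤ 1 ∧ dist (x k') (x l) ≤ 1).card = 5 with hTdef
  have hmemT : ∀ a : Fin N, a ∈ T ↔ a ≠ j ∧ dist (x j) (x a) ≤ 1 ∧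
      (Finset.univ.filter fun l : Fin N =>
        l ≠ j ∧ l ≠ a ∧ dist (x j) (x l) ≤ 1 ∧ dist (x a) (x l) ≤ 1).card = 5 := by
    intro a
    rw [hTdef, Finset.mem_filter]
    exact ⟨fun h => h.2, fun h => ⟨Finset.mem_univ _, h⟩⟩
  have hkT : k ∈ T := (hmemT k).2 ⟨hjk.symm, hdjk, h5⟩
  obtain ⟨k', hk'j, hk'k, hdjk', hk'5⟩ := hEX N x j k hGood hDich hjk hdjk h5
  have hk'T : k' ∈ T := (hmemT k').2 ⟨hk'j, hdjk', hk'5⟩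
  have h2le : 2 ≤ T.card := by
    calc 2 = ({k, k'} : Finset (Fin N)).card := (Finset.card_pair (Ne.symm hk'k)).symm
      _ ≤ T.card := Finset.card_le_card (by
          intro a ha
          rcases Finset.mem_insert.mp ha with rfl | ha
          · exact hkT
          · rw [Finset.mem_singleton.mp ha]; exact hk'T)
  refine le_antisymm ?_ h2le
  by_contra hlt
  rw [not_le] at hlt
  obtain ⟨a, b, c, haT, hbT, hcT, hab, hac, hbc⟩ := Finset.two_lt_card_iff.mp hlt
  obtain ⟨haj, hdja, ha5⟩ := (hmemT a).1 haT
  obtain ⟨hbj, hdjb, hb5⟩ := (hmemT b).1 hbT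
  obtain ⟨hcj, hdjc, hc5⟩ := (hmemT c).1 hcT
  -- the three bond vectors are non-zero (separation at `j`)
  have hsepj : ∀ a : Fin N, a ≠ j → (55 : ℝ) / 57 ≤ dist (x j) (x a) :=
    fun a haj => hGood.1 j (by rw [dist_self]; norm_num) a haj
  have hpos : ∀ a : Fin N, a ≠ j → 0 < ‖x a - x j‖ := by
    intro a haj
    rw [← dist_eq_norm, dist_comm]
    exact lt_of_lt_of_le (by norm_num) (hsepj a haj)
  exact not_three_pairwise_antipodal (x a - x j) (x b - x j) (x c - x j) (hpos a haj) (hpos b hbj)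
    (hpos c hcj) (hangle a b haj hdja ha5 hbj hdjb hb5 hab.symm)
    (hangle a c haj hdja ha5 hcj hdjc hc5 hac.symm) (hangle b c hbj hdjb hb5 hcj hdjc hc5 hbc.symm)

/-- Registered sub-goal form (closed statement) of `fiveFoldContinuation_of_parts`: the three
parts (ADJ: no adjacent five-fold bonds; FAR: non-adjacent five-fold bonds are antipodal;
EX: a second five-fold bond exists) imply the registered stub `stub_fiveFoldContinuation`
(S2β) of line `Sketch`. [folklore] -/
theorem stub_fiveFoldContinuationOfParts :
    (∀ (N : ℕ) (x : Fin N → EuclideanSpace ℝ (Fin 3)) (j k : Fin N),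
      ((∀ j' : Fin N, dist (x j) (x j') ≤ 11 / 10 → ∀ k' : Fin N, k' ≠ j' →
          (55 : ℝ) / 57 ≤ dist (x j') (x k')) ∧
        (Finset.univ.filter fun j' : Fin N => j' ≠ j ∧ dist (x j) (x j') ≤ 1).card = 12 ∧
        (Finset.univ.filter fun j' : Fin N => j' ≠ j ∧ dist (x j) (x j') ≤ 11 / 10).card ≤ 12) →
      (∀ l l' : Fin N, dist (x j) (x l) ≤ 1 → dist (x j) (x l') ≤ 1 → 1 < dist (x l) (x l') →
        (131 : ℝ) / 100 ≤ dist (x l) (x l')) →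
      j ≠ k → dist (x j) (x k) ≤ 1 →
      (Finset.univ.filter fun l : Fin N =>
        l ≠ j ∧ l ≠ k ∧ dist (x j) (x l) ≤ 1 ∧ dist (x k) (x l) ≤ 1).card = 5 →
      ∀ k' : Fin N, k' ≠ j → k' ≠ k → dist (x j) (x k') ≤ 1 →
        (Finset.univ.filter fun l : Fin N =>
          l ≠ j ∧ l ≠ k' ∧ dist (x j) (x l) ≤ 1 ∧ dist (x k') (x l) ≤ 1).card = 5 →
        1 < dist (x k) (x k')) →
    (∀ (N : ℕ) (x : Fin N → EuclideanSpace ℝ (Fin 3)) (j k : Fin N),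
      ((∀ j' : Fin N, dist (x j) (x j') ≤ 11 / 10 → ∀ k' : Fin N, k' ≠ j' →
          (55 : ℝ) / 57 ≤ dist (x j') (x k')) ∧
        (Finset.univ.filter fun j' : Fin N => j' ≠ j ∧ dist (x j) (x j') ≤ 1).card = 12 ∧
        (Finset.univ.filter fun j' : Fin N => j' ≠ j ∧ dist (x j) (x j') ≤ 11 / 10).card ≤ 12) →
      (∀ l l' : Fin N, dist (x j) (x l) ≤ 1 → dist (x j) (x l') ≤ 1 → 1 < dist (x l) (x l') →
        (131 : ℝ) / 100 ≤ dist (x l) (x l')) →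
      j ≠ k → dist (x j) (x k) ≤ 1 →
      (Finset.univ.filter fun l : Fin N =>
        l ≠ j ∧ l ≠ k ∧ dist (x j) (x l) ≤ 1 ∧ dist (x k) (x l) ≤ 1).card = 5 →
      ∀ k' : Fin N, k' ≠ j → dist (x j) (x k') ≤ 1 →
        (Finset.univ.filter fun l : Fin N =>
          l ≠ j ∧ l ≠ k' ∧ dist (x j) (x l) ≤ 1 ∧ dist (x k') (x l) ≤ 1).card = 5 →
        1 < dist (x k) (x k') →
        inner ℝ (x k - x j) (x k' - x j) ≤ -((19 : ℝ) / 20) * (‖x k - x j‖ * ‖x k' - x j‖)) →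
    (∀ (N : ℕ) (x : Fin N → EuclideanSpace ℝ (Fin 3)) (j k : Fin N),
      ((∀ j' : Fin N, dist (x j) (x j') ≤ 11 / 10 → ∀ k' : Fin N, k' ≠ j' →
          (55 : ℝ) / 57 ≤ dist (x j') (x k')) ∧
        (Finset.univ.filter fun j' : Fin N => j' ≠ j ∧ dist (x j) (x j') ≤ 1).card = 12 ∧
        (Finset.univ.filter fun j' : Fin N => j' ≠ j ∧ dist (x j) (x j') ≤ 11 / 10).card ≤ 12) →
      (∀ l l' : Fin N, dist (x j) (x l) ≤ 1 → dist (x j) (x l') ≤ 1 → 1 < dist (x l) (x l') →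
        (131 : ℝ) / 100 ≤ dist (x l) (x l')) →
      j ≠ k → dist (x j) (x k) ≤ 1 →
      (Finset.univ.filter fun l : Fin N =>
        l ≠ j ∧ l ≠ k ∧ dist (x j) (x l) ≤ 1 ∧ dist (x k) (x l) ≤ 1).card = 5 →
      ∃ k' : Fin N, k' ≠ j ∧ k' ≠ k ∧ dist (x j) (x k') ≤ 1 ∧
        (Finset.univ.filter fun l : Fin N =>
          l ≠ j ∧ l ≠ k' ∧ dist (x j) (x l) ≤ 1 ∧ dist (x k') (x l) ≤ 1).card = 5) →
    ∀ (N : ℕ) (x : Fin N → EuclideanSpace ℝ (Fin 3)) (j k : Fin N),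
      ((∀ j' : Fin N, dist (x j) (x j') ≤ 11 / 10 → ∀ k' : Fin N, k' ≠ j' →
          (55 : ℝ) / 57 ≤ dist (x j') (x k')) ∧
        (Finset.univ.filter fun j' : Fin N => j' ≠ j ∧ dist (x j) (x j') ≤ 1).card = 12 ∧
        (Finset.univ.filter fun j' : Fin N => j' ≠ j ∧ dist (x j) (x j') ≤ 11 / 10).card ≤ 12) →
      (∀ l l' : Fin N, dist (x j) (x l) ≤ 1 → dist (x j) (x l') ≤ 1 → 1 < dist (x l) (x l') →
        (131 : ℝ) / 100 ≤ dist (x l) (x l')) →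
      j ≠ k → dist (x j) (x k) ≤ 1 →
      (Finset.univ.filter fun l : Fin N =>
        l ≠ j ∧ l ≠ k ∧ dist (x j) (x l) ≤ 1 ∧ dist (x k) (x l) ≤ 1).card = 5 →
      (Finset.univ.filter fun k' : Fin N => k' ≠ j ∧ dist (x j) (x k') ≤ 1 ∧
        (Finset.univ.filter fun l : Fin N =>
          l ≠ j ∧ l ≠ k' ∧ dist (x j) (x l) ≤ 1 ∧ dist (x k') (x l) ≤ 1).card = 5).card = 2 ∧
      ∀ k' : Fin N, k' ≠ j → dist (x j) (x k') ≤ 1 →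
        (Finset.univ.filter fun l : Fin N =>
          l ≠ j ∧ l ≠ k' ∧ dist (x j) (x l) ≤ 1 ∧ dist (x k') (x l) ≤ 1).card = 5 → k' ≠ k →
        inner ℝ (x k - x j) (x k' - x j) ≤ -((19 : ℝ) / 20) * (‖x k - x j‖ * ‖x k' - x j‖) :=
  fun hADJ hFAR hEX => fiveFoldContinuation_of_parts hADJ hFAR hEX

end Summit.AtomisticToContinuum.Crystallization.Theorems.SquareWellLayerCakeGapTwelveToBarlow
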